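import Literature.IUT.LogThetaLattice.RealifiedSemisimplificationProofsB
import HarnessLib

/-!
# [IUTchIII] Remark 3.9.4 (vi), the LITERAL typing `Remark394vi_expPreservesVolume` (FACT-LIST F-0432):
# the direct-head instance that HOLDS — the principal-branch window of `log_k(𝒪^×_k)` (proof-only)

S. Mochizuki, *Inter-universal Teichmüller theory III*, kurims manuscript (May 2020), §3, Remark 3.9.4 (vi),
p. 125 l. 36 – p. 126 l. 40: at an archimedean `k ≅ ℂ` the diagram
`|k| ↞ k ⊇ 𝒪^×_k ←^{exp_k} log_k(𝒪^×_k) ⊆ k ↠ |k|` "induces `ℝ_{>0}`-equivariant isomorphisms of monoids on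
the respective realified semi-simplifications … [i.e., by considering ample `S ⊆ log_k(𝒪^×_k)` that map
bijectively to `exp_k(S) ⊆ 𝒪^×_k` — cf. [AbsTopIII], Proposition 5.7, (ii), (c)] by the universal covering map
`exp_k|_{log_k(𝒪^×_k)}`", with `log_k(𝒪^×_k) := exp_k^{-1}(𝒪^×_k)` (p. 126 l. 40–41).
[claim: Mochizuki2012, status: disputed] (IUTchIII §3 Rmk 3.9.4 (vi), kurims pp.125-126) — the content
decided below is undisputed Lebesgue measure theory.

PROOF-ONLY companion (abc-iut cell, block F, KEY row INST59D, seat abc-iut-f-055; 0 `def` / `structure`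
/ `instance`, no `Prop` fact) of abc-iut-L6-t4's `RealifiedSemisimplification.lean`, FACT-LIST row **F-0432**
`Remark394vi_expPreservesVolume L expk volAng volLin := ∀ S ⊆ L, InjOn expk S → volAng (expk '' S) = volLin S`
— the LITERAL, hypothesis-free-in-`S` typing (flagged in its own docstring as a recorded mis-typing; the
corrected "ample"/compact typing `Remark394vi_expPreservesVolume'` is PROVED at the model of record,
abc-iut-L6-d4's `Remark394vi_expPreservesVolume'_holds`).  State of the literal row in the tree: REFUTED at
the model of record `(L, expk, volAng, volLin) = (iℝ, exp, ofReal ∘ μ̆_k, Lebesgue ∘ im)`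
(`not_Remark394vi_expPreservesVolume_arch`, `not_forall_Remark394vi_expPreservesVolume`, Vitali witness
spread over infinitely many periods of `exp`, `RealifiedSemisimplificationRmk394viUnprimedRefuted.lean`), and
the L-F kernel census (plan/LF-KERNEL-STATUS.tsv, 2026-08-27, col 14) found NO theorem whose conclusion head
is `Remark394vi_expPreservesVolume`.

THE INSTANCE THE REFUTER SPARES (this file).  Keep the archimedean model of record — `k = ℂ`,
`expk = exp`, `volAng = ENNReal.ofReal ∘ μ̆_k` (abc-iut-L4-t3's angular volume
`ComplexVolume.angularVolume A = (volume (phase '' A)).toReal`, [AbsTopIII] Prop. 5.7 (ii)(a): arc length on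
`𝒪^×_k = ℝ/2πℤ`), `volLin S = volume (im '' S)` (Lebesgue measure along `iℝ`) — but take for `L` ONE
PRINCIPAL-BRANCH WINDOW `I_a := {z ∈ iℝ : im z ∈ (a, a + 2π]}` of `log_k(𝒪^×_k) = iℝ`, a fundamental
domain of the universal covering `exp : iℝ → 𝒪^×_k`.  Then the LITERAL row HOLDS, for EVERY `S ⊆ I_a`,
measurable or not (`Remark394vi_expPreservesVolume_window`): `exp` is injective on `I_a`, and OUTER Lebesgue
measure transports along the bijection `θ ↦ θ mod 2π` of `(a, a + 2π]` onto `ℝ/2πℤ`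
(`AddCircle.volume_image_coe_of_subset_Ioc`, from Mathlib's `AddCircle.measurePreserving_equivIoc` and the
measurable embedding `(a, a + 2π] ↪ ℝ`; no measurability of `S` is needed because a measurable BIJECTION
identifies the outer measures).  The refuter's witness needs `S` to meet infinitely many windows; inside one
window the non-measurable pathology cannot occur.  HONEST LABEL: an instance at a SUB-domain of print's
`L = exp_k^{-1}(𝒪^×_k)` (the window is where print's steps (a)–(c), arcs of measure `< ε` and their translates
to `0`, take place); the literal row at print's full `L` stays REFUTED-AT-MODEL and the corrected row
PROVED; no new reading of print is proposed.  Also recorded: antitonicity of the literal row in `L`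
(`Remark394vi_expPreservesVolume.anti`), so it holds on every subset of a window, e.g. on print's arcs.
Nothing here bears on [IUTchIII] Cor. 3.12; no side taken; typed ≠ proved for the disputed corpus.
-/

set_option autoImplicit false

noncomputable section

open MeasureTheory MeasureTheory.Measure Set
open scoped ENNReal

/-! ## Outer Lebesgue measure transports along one period of `ℝ → ℝ/Tℤ` -/

namespace AddCircle

/-- **Outer Lebesgue measure is preserved by `θ ↦ θ mod T` on ONE period**, for ARBITRARY subsets: if
`S ⊆ (a, a + T]` then the Haar measure (total mass `T`) of its image in `ℝ/Tℤ` equals `volume S` — the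
restriction of the quotient map to the window is a measurable bijection identifying the two (outer)
measures (`AddCircle.measurePreserving_equivIoc`).  File-private helper in Mathlib's `AddCircle` namespace
(dot-notation convenience only). [folklore] -/
private theorem volume_image_coe_of_subset_Ioc (T : ℝ) [hT : Fact (0 < T)] (a : ℝ) {S : Set ℝ}
    (hS : S ⊆ Ioc a (a + T)) :
    volume (((↑) : ℝ → AddCircle T) '' S) = volume S := by
  set U : Set (AddCircle T) := ((↑) : ℝ → AddCircle T) '' S with hU
  have hmp := AddCircle.measurePreserving_equivIoc T (a := a)
  have hemb : MeasurableEmbedding ((↑) : Ioc a (a + T) → ℝ) := MeasurableEmbedding.subtype_coe measurableSet_Ioc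
  -- `volume U = (comap val volume) (equivIoc '' U)` (measure-preserving measurable bijection)
  have h1 : volume U = (Measure.comap ((↑) : Ioc a (a + T) → ℝ) volume)
      ((AddCircle.measurableEquivIoc T a) '' U) := by
    rw [← hmp.map_eq]
    change volume U = Measure.map (AddCircle.measurableEquivIoc T a) volume
      ((AddCircle.measurableEquivIoc T a) '' U)
    rw [MeasurableEquiv.map_apply, (AddCircle.measurableEquivIoc T a).injective.preimage_image]
  -- `(comap val volume) A = volume (val '' A)` for every `A` (measurable embedding)
  rw [h1, hemb.comap_apply]
  congr 1
  ext x
  constructor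
  · rintro ⟨y, ⟨u, ⟨s, hs, rfl⟩, rfl⟩, rfl⟩
    change ((AddCircle.equivIoc T a (s : AddCircle T) : Ioc a (a + T)) : ℝ) ∈ S
    rw [AddCircle.equivIoc_coe_eq (hS hs)]
    exact hs
  · intro hx
    refine ⟨⟨x, hS hx⟩, ⟨(x : AddCircle T), ⟨x, hx, rfl⟩, ?_⟩, rfl⟩
    change AddCircle.equivIoc T a (x : AddCircle T) = ⟨x, hS hx⟩
    exact AddCircle.equivIoc_coe_eq (hS hx)

end AddCircle

namespace Literature.IUT.LogThetaLattice

open Complex Literature.AnabelianGeometry.AbsoluteAnabelian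

/-- **The literal row is ANTITONE in `L`**: if it holds on `L` it holds on every `L' ⊆ L` (direct-head,
used to pass from a window to print's small arcs). [claim: Mochizuki2012, status: disputed] (IUTchIII §3 Rmk 3.9.4 (vi), kurims p.126) -/
theorem Remark394vi_expPreservesVolume.anti {k : Type*} {L L' : Set k} {expk : k → k}
    {volAng volLin : Set k → ℝ≥0∞} (h : Remark394vi_expPreservesVolume L expk volAng volLin) (hL : L' ⊆ L) :
    Literature.IUT.LogThetaLattice.Remark394vi_expPreservesVolume L' expk volAng volLin :=
  fun S hS hinj => h S (hS.trans hL) hinj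

/-- The projection to `𝒪_k^× = ℝ/2πℤ` of `exp_k(it)` is `t mod 2π`; file-private helper (abc-iut-L6-d4's
twin in `RealifiedSemisimplificationProofsB` is private there). [folklore] -/
private theorem phase_exp_ofReal_mul_I' (t : ℝ) :
    ComplexVolume.phase (exp (t * I)) = ((t : ℝ) : AddCircle (2 * Real.pi)) := by
  unfold ComplexVolume.phase
  rw [arg_exp_mul_I]
  exact Real.Angle.coe_toIocMod t (-Real.pi)

/-- **F-0432, the LITERAL `Remark394vi_expPreservesVolume`, HOLDS on a principal-branch window** of
`log_k(𝒪^×_k) = iℝ` at the archimedean model of record: for `L = I_a := {z : re z = 0, im z ∈ (a, a + 2π]}`,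
`expk = exp`, `volAng = ENNReal.ofReal ∘ μ̆_k` ([AbsTopIII] Prop. 5.7 (ii)(a) angular volume) and
`volLin S = volume (im '' S)`, EVERY `S ⊆ I_a` (no measurability, the injectivity hypothesis is automatic)
satisfies `μ̆_k(exp(S)) = volLin(S)`: `phase ∘ exp` is `θ ↦ θ mod 2π` on `iℝ`, and outer Lebesgue measure
transports along one period (`AddCircle.volume_image_coe_of_subset_Ioc`).  The instance the closure refuter
`not_Remark394vi_expPreservesVolume_arch` (print's full `L = iℝ`) spares.
[claim: Mochizuki2012, status: disputed] (IUTchIII §3 Rmk 3.9.4 (vi), kurims pp.125-126) -/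
theorem Remark394vi_expPreservesVolume_window (a : ℝ) :
    Literature.IUT.LogThetaLattice.Remark394vi_expPreservesVolume
      {z : ℂ | z.re = 0 ∧ z.im ∈ Ioc a (a + 2 * Real.pi)} exp
      (fun A => ENNReal.ofReal (ComplexVolume.angularVolume A)) (fun S => volume (Complex.im '' S)) := by
  intro S hSL _
  show ENNReal.ofReal (ComplexVolume.angularVolume (exp '' S)) = volume (Complex.im '' S)
  unfold ComplexVolume.angularVolume
  -- points of `S` are `i·t`
  have hz : ∀ z ∈ S, ((z.im : ℝ) : ℂ) * I = z := fun z hzS => by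
    have hre : z.re = 0 := (hSL hzS).1
    apply Complex.ext <;> simp [hre]
  have himage : ComplexVolume.phase '' (exp '' S) =
      (fun t : ℝ => (t : AddCircle (2 * Real.pi))) '' (Complex.im '' S) := by
    rw [image_image, image_image]
    refine Set.image_congr fun z hzS => ?_
    conv_lhs => rw [← hz z hzS]
    exact phase_exp_ofReal_mul_I' z.im
  have hsub : Complex.im '' S ⊆ Ioc a (a + 2 * Real.pi) := by
    rintro _ ⟨z, hz, rfl⟩
    exact (hSL hz).2
  haveI : Fact (0 < 2 * Real.pi) := ⟨Real.two_pi_pos⟩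
  rw [himage, AddCircle.volume_image_coe_of_subset_Ioc (2 * Real.pi) a hsub]
  exact ENNReal.ofReal_toReal
    ((measure_mono hsub).trans_lt measure_Ioc_lt_top).ne

/-- **The literal row on every subset of a window**, e.g. on print's closed arcs of measure `< ε`
translated into `(a, a + 2π]` (steps (a)–(b) of Rmk. 3.9.4 (vi)): by antitonicity.
[claim: Mochizuki2012, status: disputed] (IUTchIII §3 Rmk 3.9.4 (vi), kurims p.126) -/
theorem Remark394vi_expPreservesVolume_of_subset_window {a : ℝ} {L : Set ℂ}
    (hL : L ⊆ {z : ℂ | z.re = 0 ∧ z.im ∈ Ioc a (a + 2 * Real.pi)}) :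
    Literature.IUT.LogThetaLattice.Remark394vi_expPreservesVolume L exp
      (fun A => ENNReal.ofReal (ComplexVolume.angularVolume A)) (fun S => volume (Complex.im '' S)) :=
  (Remark394vi_expPreservesVolume_window a).anti hL

end Literature.IUT.LogThetaLattice

end
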